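import Summits.RiemannHypothesis.RiemannHypothesis.Theorems.SemilocalDeletionPairCombs
import HarnessLib

/-!
# Two-prime deletion costs are ASYMPTOTICALLY ADDITIVE (sequel of `SemilocalDeletionPairCombs`)

`SemilocalDeletionPairCombs.lean` (p379698) computed the deletion of two distinct primes `p, q ∈ S` under a two-dimensional alternating comb
EXACTLY — the sum of the two one-prime comb values, no interaction term — under a LATTICE SEPARATION hypothesis on the block half-width `δ`
(`2δ < |a·log p + b·log q|` on a finite box of `(a, b) ≠ 0`).  This file discharges that hypothesis and packages the result:

* §1 `int_mul_log_add_eq_zero`: `a·log p + b·log q = 0` with integers `a, b` forces `a = b = 0` (unique factorisation: `p^|a| = q^|b|`);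
  `exists_separation`: for every box there is `δ > 0` with the separation property (a finite set of nonzero reals has a positive minimum).
* §2 `alt_comb_sum_eq` / `alt_comb_sum_le`: the alternating comb sum `Σ_{d<n}(n−d)(−ρ)^{d+1}` in closed form and `≤ −ρ(n−1)/(1+ρ)`.
* §3 `re_erase_erase_comb2_le`: `Re Q_{S∖{p,q}}(G) − Re Q_S(G) ≤ −[F_p·(n−1)/(n+1) + F_q·(n'−1)/(n'+1)]·‖G‖₂²`, `F_r = 2·log r/(√r + 1)`;
  ★ `exists_re_erase_erase_sub_le`: for distinct primes `p, q ∈ S` and EVERY `n, n'` there are a window and a Weil test function whose two-prime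
  deletion quotient is `≤ −[F_p(n−1)/(n+1) + F_q(n'−1)/(n'+1)]` — within `2F_p/(n+1) + 2F_q/(n'+1)` of `−(F_p + F_q)`.

With the all-window floor (`SemilocalDeletionAllWindowFloor.semilocalGroundEnergy_sdiff_ge_allWindow`: the two-prime cost is `≥ −(F_p + F_q)` at every
window) this says: the two-prime ALL-WINDOW deletion floor is exactly `F_p + F_q` — the prime–prime INTERACTION of deletion costs, positive and
large at finite windows (lineage E, HOME/cc-s2-1/gen14/PAIRWINDOW-LAW.md: 20–35 % lag geometry, 65–80 % joint-attainability deficit), VANISHES in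
the all-window limit.  Nothing here bears on RH; these are statements about truncated Weil forms.
-/

set_option linter.dupNamespace false

noncomputable section

open Complex Filter Set MeasureTheory
open scoped Real Topology ComplexConjugate

namespace Summit.RiemannHypothesis.RiemannHypothesis.Theorems.SemilocalDeletionPairCombs

open Literature.NumberTheory.LFunctions
open Summit.RiemannHypothesis.RiemannHypothesis.Theorems.HandoffSemilocalEnergy

/-! ## §1  Lattice separation: `|a·log p + b·log q|` is bounded away from `0` on finite boxes (distinct primes) -/

/-- For distinct primes, `a·log p + b·log q = 0` with integers `a, b` forces `a = b = 0` (unique factorisation: `p^a = q^b`). -/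
private theorem int_mul_log_add_eq_zero {p q : ℕ} (hp : p.Prime) (hq : q.Prime) (hpq : p ≠ q) {a b : ℤ}
    (h : (a : ℝ) * Real.log p + b * Real.log q = 0) : a = 0 ∧ b = 0 := by
  have hp1 : (1 : ℝ) < p := by exact_mod_cast hp.one_lt
  have hq1 : (1 : ℝ) < q := by exact_mod_cast hq.one_lt
  have hlp : 0 < Real.log p := Real.log_pos hp1
  have hlq : 0 < Real.log q := Real.log_pos hq1
  -- `p^|a| = q^|b|` as naturals, from `|a| log p = |b| log q`
  have key : ∀ {a b : ℕ}, (a : ℝ) * Real.log p = b * Real.log q → a = 0 ∧ b = 0 := by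
    intro a b hab
    have hpow : (p : ℝ) ^ a = (q : ℝ) ^ b := by
      have := congrArg Real.exp hab
      rwa [← Real.log_pow, ← Real.log_pow, Real.exp_log (by positivity), Real.exp_log (by positivity)] at this
    have hnat : p ^ a = q ^ b := by exact_mod_cast hpow
    rcases Nat.eq_zero_or_pos a with ha | ha
    · subst ha
      rw [pow_zero] at hnat
      rcases Nat.eq_zero_or_pos b with hb | hb
      · exact ⟨rfl, hb⟩
      · exfalso
        have : 1 < q ^ b := Nat.one_lt_pow hb.ne' hq.one_lt
        omega
    · exfalso
      have hdvd : p ∣ q ^ b := by rw [← hnat]; exact dvd_pow_self p ha.ne'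
      exact hpq ((Nat.prime_dvd_prime_iff_eq hp hq).1 (hp.dvd_of_dvd_pow hdvd))
  -- signs: `a log p = −b log q`; both sides have the sign of `a` resp. `−b`
  rcases le_or_gt 0 a with ha | ha <;> rcases le_or_gt 0 b with hb | hb
  · -- a ≥ 0, b ≥ 0: sum of nonnegatives is 0
    have ha' : (0 : ℝ) ≤ a := by exact_mod_cast ha
    have hb' : (0 : ℝ) ≤ b := by exact_mod_cast hb
    have h1 : (a : ℝ) * Real.log p = 0 := by nlinarith [mul_nonneg ha' hlp.le, mul_nonneg hb' hlq.le]
    have h2 : (b : ℝ) * Real.log q = 0 := by linarith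
    exact ⟨by exact_mod_cast (mul_eq_zero.1 h1).resolve_right hlp.ne', by exact_mod_cast (mul_eq_zero.1 h2).resolve_right hlq.ne'⟩
  · -- a ≥ 0, b < 0: a log p = (-b) log q with naturals a.toNat, (-b).toNat
    have hab : ((a.toNat : ℕ) : ℝ) * Real.log p = ((-b).toNat : ℕ) * Real.log q := by
      have e1 : ((a.toNat : ℕ) : ℝ) = (a : ℝ) := by exact_mod_cast Int.toNat_of_nonneg ha
      have e2 : (((-b).toNat : ℕ) : ℝ) = ((-b : ℤ) : ℝ) := by exact_mod_cast Int.toNat_of_nonneg (by omega)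
      rw [e1, e2]; push_cast; linarith
    have := key hab
    omega
  · have hab : (((-a).toNat : ℕ) : ℝ) * Real.log p = ((b.toNat : ℕ) : ℝ) * Real.log q := by
      have e1 : (((-a).toNat : ℕ) : ℝ) = ((-a : ℤ) : ℝ) := by exact_mod_cast Int.toNat_of_nonneg (by omega)
      have e2 : ((b.toNat : ℕ) : ℝ) = (b : ℝ) := by exact_mod_cast Int.toNat_of_nonneg hb
      rw [e1, e2]; push_cast; linarith
    have := key hab
    omega
  · have h1 : (a : ℝ) * Real.log p < 0 := mul_neg_of_neg_of_pos (by exact_mod_cast ha) hlp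
    have h2 : (b : ℝ) * Real.log q < 0 := mul_neg_of_neg_of_pos (by exact_mod_cast hb) hlq
    linarith

/-- **Separation.** For distinct primes `p, q` and bounds `A, B` there is `δ > 0` with `2δ < |a·log p + b·log q|` for all integers
`|a| ≤ A`, `|b| ≤ B`, `(a, b) ≠ (0, 0)`. -/
theorem exists_separation {p q : ℕ} (hp : p.Prime) (hq : q.Prime) (hpq : p ≠ q) (A B : ℕ) :
    ∃ δ : ℝ, 0 < δ ∧ ∀ a b : ℤ, |a| ≤ A → |b| ≤ B → (a ≠ 0 ∨ b ≠ 0) → 2 * δ < |(a : ℝ) * Real.log p + b * Real.log q| := by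
  classical
  set box : Finset (ℤ × ℤ) := ((Finset.Icc (-(A : ℤ)) A) ×ˢ (Finset.Icc (-(B : ℤ)) B)).erase (0, 0) with hbox
  set f : ℤ × ℤ → ℝ := fun ab ↦ |(ab.1 : ℝ) * Real.log p + ab.2 * Real.log q| with hf
  have hfpos : ∀ ab ∈ box, 0 < f ab := by
    intro ab hab
    rw [hbox, Finset.mem_erase] at hab
    rw [hf]; dsimp only
    refine abs_pos.2 fun h0 ↦ hab.1 ?_
    obtain ⟨h1, h2⟩ := int_mul_log_add_eq_zero hp hq hpq h0
    exact Prod.ext h1 h2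
  have hmem : ∀ a b : ℤ, |a| ≤ A → |b| ≤ B → (a ≠ 0 ∨ b ≠ 0) → (a, b) ∈ box := by
    intro a b ha hb hab
    rw [hbox, Finset.mem_erase, Finset.mem_product, Finset.mem_Icc, Finset.mem_Icc]
    refine ⟨fun h ↦ ?_, (abs_le.1 ha), (abs_le.1 hb)⟩
    simp only [Prod.mk.injEq] at h
    rcases hab with h' | h' <;> omega
  rcases box.eq_empty_or_nonempty with he | hne
  · refine ⟨1, one_pos, fun a b ha hb hab ↦ ?_⟩
    have := hmem a b ha hb hab
    rw [he] at this
    simp at this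
  · obtain ⟨ab₀, hab₀, hmin⟩ := Finset.exists_min_image box f hne
    refine ⟨f ab₀ / 4, by linarith [hfpos ab₀ hab₀], fun a b ha hb hab ↦ ?_⟩
    have := hmin (a, b) (hmem a b ha hb hab)
    have h0 := hfpos ab₀ hab₀
    rw [hf] at this; dsimp only at this
    linarith


/-- Closed form of the alternating comb sum at `x = −ρ`: `(1+ρ)²·Σ_{d<n}(n−d)(−ρ)^{d+1} = −nρ(1+ρ) − ρ²(1 − (−ρ)^n)`. -/
theorem alt_comb_sum_eq (ρ : ℝ) (n : ℕ) :
    (1 + ρ) ^ 2 * ∑ d ∈ Finset.range n, ((n : ℝ) - d) * (-ρ) ^ (d + 1) = -(n * ρ * (1 + ρ)) - ρ ^ 2 * (1 - (-ρ) ^ n) := by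
  induction n with
  | zero => simp
  | succ n ih =>
    have hsplit : ∑ d ∈ Finset.range (n + 1), (((n + 1 : ℕ) : ℝ) - d) * (-ρ) ^ (d + 1) =
        (∑ d ∈ Finset.range n, ((n : ℝ) - d) * (-ρ) ^ (d + 1)) + (-ρ) * ∑ d ∈ Finset.range (n + 1), (-ρ) ^ d := by
      calc ∑ d ∈ Finset.range (n + 1), (((n + 1 : ℕ) : ℝ) - d) * (-ρ) ^ (d + 1)
          = ∑ d ∈ Finset.range (n + 1), (((n : ℝ) - d) * (-ρ) ^ (d + 1) + (-ρ) * (-ρ) ^ d) :=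
            Finset.sum_congr rfl fun d _ ↦ by push_cast; ring
        _ = (∑ d ∈ Finset.range (n + 1), ((n : ℝ) - d) * (-ρ) ^ (d + 1)) + ∑ d ∈ Finset.range (n + 1), (-ρ) * (-ρ) ^ d :=
            Finset.sum_add_distrib
        _ = _ := by rw [Finset.sum_range_succ, Finset.mul_sum]; simp
    have hgeom : (∑ d ∈ Finset.range (n + 1), (-ρ) ^ d) * (-ρ - 1) = (-ρ) ^ (n + 1) - 1 := geom_sum_mul (-ρ) (n + 1)
    rw [hsplit, mul_add, ih]
    have : (1 + ρ) ^ 2 * (-ρ * ∑ d ∈ Finset.range (n + 1), (-ρ) ^ d) = ρ * (1 + ρ) * ((∑ d ∈ Finset.range (n + 1), (-ρ) ^ d) * (-ρ - 1)) := by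
      ring
    rw [this, hgeom]; push_cast; ring

/-- The alternating comb sum is at most `−ρ(n−1)/(1+ρ)`: `(1+ρ)·Σ_{d<n}(n−d)(−ρ)^{d+1} ≤ −ρ(n − 1)` for `0 ≤ ρ < 1`. -/
theorem alt_comb_sum_le {ρ : ℝ} (hρ0 : 0 ≤ ρ) (hρ1 : ρ < 1) (n : ℕ) :
    (1 + ρ) * ∑ d ∈ Finset.range n, ((n : ℝ) - d) * (-ρ) ^ (d + 1) ≤ -(ρ * ((n : ℝ) - 1)) := by
  set T := ∑ d ∈ Finset.range n, ((n : ℝ) - d) * (-ρ) ^ (d + 1) with hT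
  have hcl := alt_comb_sum_eq ρ n
  rw [← hT] at hcl
  have hpn : (-ρ) ^ n ≤ 1 := by
    have : |(-ρ) ^ n| ≤ 1 := by rw [abs_pow, abs_neg, abs_of_nonneg hρ0]; exact pow_le_one₀ hρ0 hρ1.le
    exact (abs_le.1 this).2
  have h1 : (1 + ρ) * ((1 + ρ) * T + ρ * ((n : ℝ) - 1)) = -(ρ * (1 + ρ)) - ρ ^ 2 * (1 - (-ρ) ^ n) := by nlinarith [hcl]
  have h2 : (1 + ρ) * ((1 + ρ) * T + ρ * ((n : ℝ) - 1)) ≤ 0 := by rw [h1]; nlinarith [pow_nonneg hρ0 2]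
  nlinarith


/-! ## §3  The packaged bound and the existence of separated combs: two-prime deletion costs are ASYMPTOTICALLY ADDITIVE -/

section Pair

variable {h : ℝ → ℂ} {δ L M : ℝ} {n n' : ℕ} {A B : ℕ} {G : ℝ → ℂ} {S : Finset ℕ} {p q : ℕ} {mp mq : ℕ}
  (hG : ∀ t : ℝ, G t = ∑ ij ∈ Finset.range (n + 1) ×ˢ Finset.range (n' + 1),
    ((-1 : ℂ) ^ (ij.1 + ij.2)) * h (t + (n * L + n' * M) / 2 - ij.1 * L - ij.2 * M))
  (hsep : ∀ a b : ℤ, |a| ≤ A → |b| ≤ B → (a ≠ 0 ∨ b ≠ 0) → 2 * δ < |(a : ℝ) * L + b * M|)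
include hG hsep

/-- **Two primes: the comb beats the sum of the floors up to `2F_p/(n+1) + 2F_q/(n'+1)`.** Under the hypotheses of
`re_erase_erase_comb2`: `Re Q_{S∖{p,q}}(G) − Re Q_S(G) ≤ −[F_p·(n−1)/(n+1) + F_q·(n'−1)/(n'+1)]·‖G‖₂²`, `F_r = 2·log r/(√r + 1)`. -/
theorem re_erase_erase_comb2_le (hh : IsWeilTest h) (hsupp : tsupport h ⊆ Icc (-δ) δ) (hp : p.Prime) (hq : q.Prime) (hpq : p ≠ q)
    (hpS : p ∈ S) (hqS : q ∈ S) (hLp : L = Real.log p) (hMq : M = Real.log q) (hn : n ≤ mp) (hn' : n' ≤ mq)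
    (hwp : 2 * ((n * L + n' * M) / 2 + δ) < (mp + 1) * L) (hwq : 2 * ((n * L + n' * M) / 2 + δ) < (mq + 1) * M)
    (hA : n + mp ≤ A) (hB : n' + mq ≤ B) :
    (weilSemilocalQuadratic ((S.erase p).erase q) G).re - (weilSemilocalQuadratic S G).re ≤
      -(2 * Real.log p / (Real.sqrt p + 1) * (((n : ℝ) - 1) / (n + 1)) + 2 * Real.log q / (Real.sqrt q + 1) * (((n' : ℝ) - 1) / (n' + 1))) *
        ∫ u : ℝ, ‖G u‖ ^ 2 := by
  have hL0 : 0 < L := by rw [hLp]; exact Real.log_pos (by exact_mod_cast hp.one_lt)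
  have hM0 : 0 < M := by rw [hMq]; exact Real.log_pos (by exact_mod_cast hq.one_lt)
  rw [re_erase_erase_comb2 hG hsep hh hsupp hp hq hpq hpS hqS hLp hMq hn hn' hwp hwq hA hB,
    integral_norm_sq_comb2 hG hsep hh hsupp (le_trans (Nat.le_add_right n mp) hA) (le_trans (Nat.le_add_right n' mq) hB)]
  set N : ℝ := ∫ u : ℝ, ‖h u‖ ^ 2 with hN
  have hN0 : 0 ≤ N := integral_nonneg fun u ↦ by positivity
  -- the two one-prime comb sums
  have key : ∀ {r : ℕ} {K : ℝ} (hr : r.Prime) (hK : K = Real.log r) (m : ℕ),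
      K * ∑ d ∈ Finset.range m, ((m : ℝ) - d) * (-(Real.sqrt r)⁻¹) ^ (d + 1) ≤
        -(2 * Real.log r / (Real.sqrt r + 1)) * (((m : ℝ) - 1) / (m + 1)) * ((m : ℝ) + 1) / 2 := by
    intro r K hr hK m
    set ρ : ℝ := (Real.sqrt r)⁻¹ with hρ
    have hs1 : 1 < Real.sqrt r := by
      rw [show (1 : ℝ) = Real.sqrt 1 by simp]; exact Real.sqrt_lt_sqrt (by norm_num) (by exact_mod_cast hr.one_lt)
    have hρ0 : 0 ≤ ρ := by positivity
    have hρ1 : ρ < 1 := inv_lt_one_of_one_lt₀ hs1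
    have hK0 : 0 < K := by rw [hK]; exact Real.log_pos (by exact_mod_cast hr.one_lt)
    have hT := alt_comb_sum_le hρ0 hρ1 m
    have hconst : 2 * Real.log r / (Real.sqrt r + 1) = 2 * K * ρ / (1 + ρ) := by rw [hρ, hK]; field_simp
    rw [hconst]
    have h1ρ : 0 < 1 + ρ := by linarith
    rw [show -(2 * K * ρ / (1 + ρ)) * (((m : ℝ) - 1) / (m + 1)) * ((m : ℝ) + 1) / 2 = K * (-(ρ * ((m : ℝ) - 1))) / (1 + ρ) by
      field_simp]
    rw [le_div_iff₀ h1ρ]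
    have := mul_le_mul_of_nonneg_left hT hK0.le
    nlinarith [this]
  have k1 := key hp hLp n
  have k2 := key hq hMq n'
  have hn1 : (0 : ℝ) ≤ (n' : ℝ) + 1 := by positivity
  have hn2 : (0 : ℝ) ≤ (n : ℝ) + 1 := by positivity
  have e1 := mul_le_mul_of_nonneg_left (mul_le_mul_of_nonneg_left k1 hn1) hN0
  have e2 := mul_le_mul_of_nonneg_left (mul_le_mul_of_nonneg_left k2 hn2) hN0
  nlinarith [e1, e2]

end Pair

/-- `log q/log p < 2q` for primes (crude: `log q ≤ q − 1`, `log p ≥ log 2 > 1/2`). -/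
theorem log_div_log_lt {p q : ℕ} (hp : p.Prime) (hq : q.Prime) : Real.log q / Real.log p < 2 * q := by
  have hp2 : (2 : ℝ) ≤ p := by exact_mod_cast hp.two_le
  have hlp : Real.log 2 ≤ Real.log p := Real.log_le_log (by norm_num) hp2
  have h2 : (1 : ℝ) / 2 < Real.log 2 := by linarith [Real.log_two_gt_d9]
  have hlq : Real.log q ≤ (q : ℝ) - 1 := Real.log_le_sub_one_of_pos (by exact_mod_cast hq.pos)
  have hlp0 : 0 < Real.log p := by linarith
  rw [div_lt_iff₀ hlp0]
  have hq1 : (1 : ℝ) ≤ q := by exact_mod_cast hq.one_lt.le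
  nlinarith

/-- **ASYMPTOTIC ADDITIVITY of two-prime deletion costs.** For distinct primes `p, q ∈ S` and every `n, n'` there are a window `c` and a
Weil test function `g` on `[−c, c]` with `‖g‖₂² > 0` and
`Re Q_{S∖{p,q}}(g) − Re Q_S(g) ≤ −[F_p·(n−1)/(n+1) + F_q·(n'−1)/(n'+1)]·‖g‖₂²` — so the two-prime deletion quotient gets within
`2F_p/(n+1) + 2F_q/(n'+1)` of `−(F_p + F_q)`: the all-window two-prime floor is the SUM of the one-prime floors (no interaction in the limit). -/
theorem exists_re_erase_erase_sub_le {S : Finset ℕ} {p q : ℕ} (hp : p.Prime) (hq : q.Prime) (hpq : p ≠ q) (hpS : p ∈ S) (hqS : q ∈ S)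
    (n n' : ℕ) : ∃ c : ℝ, ∃ g : ℝ → ℂ, IsWeilTest g ∧ tsupport g ⊆ Icc (-c) c ∧ 0 < ∫ u : ℝ, ‖g u‖ ^ 2 ∧
      (weilSemilocalQuadratic ((S.erase p).erase q) g).re - (weilSemilocalQuadratic S g).re ≤
        -(2 * Real.log p / (Real.sqrt p + 1) * (((n : ℝ) - 1) / (n + 1)) +
          2 * Real.log q / (Real.sqrt q + 1) * (((n' : ℝ) - 1) / (n' + 1))) * ∫ u : ℝ, ‖g u‖ ^ 2 := by
  set L := Real.log p with hL
  set M := Real.log q with hM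
  have hL0 : 0 < L := Real.log_pos (by exact_mod_cast hp.one_lt)
  have hM0 : 0 < M := Real.log_pos (by exact_mod_cast hq.one_lt)
  -- separation box large enough for every visible power
  set A : ℕ := 2 * n + 2 * n' * q + 2 with hA
  set B : ℕ := 2 * n' + 2 * n * p + 2 with hB
  obtain ⟨δ₀, hδ₀, hsep₀⟩ := exists_separation hp hq hpq A B
  set δ : ℝ := min δ₀ (min L M / 4) with hδ
  have hδpos : 0 < δ := by rw [hδ]; exact lt_min hδ₀ (by positivity)
  have hδle : δ ≤ δ₀ := min_le_left _ _
  have hδL : 4 * δ ≤ L := by have := min_le_right δ₀ (min L M / 4); have := min_le_left L M; rw [hδ]; linarith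
  have hδM : 4 * δ ≤ M := by have := min_le_right δ₀ (min L M / 4); have := min_le_right L M; rw [hδ]; linarith
  have hsep : ∀ a b : ℤ, |a| ≤ A → |b| ≤ B → (a ≠ 0 ∨ b ≠ 0) → 2 * δ < |(a : ℝ) * L + b * M| :=
    fun a b ha hb hab ↦ lt_of_le_of_lt (by linarith) (hsep₀ a b ha hb hab)
  -- the block and the comb
  obtain ⟨x, hx⟩ := semilocalSphereValues_top_nonempty S (a := δ) hδpos
  obtain ⟨h, hh, hs, -, hn1, -⟩ := hx
  set c : ℝ := (n * L + n' * M) / 2 + δ with hc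
  set G : ℝ → ℂ := fun t ↦ ∑ ij ∈ Finset.range (n + 1) ×ˢ Finset.range (n' + 1),
    ((-1 : ℂ) ^ (ij.1 + ij.2)) * h (t + (n * L + n' * M) / 2 - ij.1 * L - ij.2 * M) with hGdef
  have hG : ∀ t, G t = ∑ ij ∈ Finset.range (n + 1) ×ˢ Finset.range (n' + 1),
    ((-1 : ℂ) ^ (ij.1 + ij.2)) * h (t + (n * L + n' * M) / 2 - ij.1 * L - ij.2 * M) := fun _ ↦ rfl
  -- visible powers of p and q on the window
  set mp : ℕ := ⌊2 * c / L⌋₊ with hmp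
  set mq : ℕ := ⌊2 * c / M⌋₊ with hmq
  have hc0 : 0 ≤ 2 * c := by rw [hc]; positivity
  have hwp : 2 * c < (mp + 1) * L := by
    have := Nat.lt_floor_add_one (2 * c / L); rw [← hmp] at this
    calc 2 * c = 2 * c / L * L := by field_simp
      _ < (mp + 1) * L := mul_lt_mul_of_pos_right this hL0
  have hwq : 2 * c < (mq + 1) * M := by
    have := Nat.lt_floor_add_one (2 * c / M); rw [← hmq] at this
    calc 2 * c = 2 * c / M * M := by field_simp
      _ < (mq + 1) * M := mul_lt_mul_of_pos_right this hM0
  have hn : n ≤ mp := by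
    refine Nat.le_floor ?_
    rw [le_div_iff₀ hL0, hc]; nlinarith [hM0.le, hδpos.le, (Nat.cast_nonneg n' : (0:ℝ) ≤ n')]
  have hn' : n' ≤ mq := by
    refine Nat.le_floor ?_
    rw [le_div_iff₀ hM0, hc]; nlinarith [hL0.le, hδpos.le, (Nat.cast_nonneg n : (0:ℝ) ≤ n)]
  have hML : M / L < 2 * q := log_div_log_lt hp hq
  have hLM : L / M < 2 * p := log_div_log_lt hq hp
  have hmpA : n + mp ≤ A := by
    have h1 : (mp : ℝ) ≤ 2 * c / L := Nat.floor_le (by positivity)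
    have h2 : 2 * c / L ≤ n + n' * (M / L) + 1 / 2 := by
      rw [hc, div_le_iff₀ hL0]
      have : n' * (M / L) * L = n' * M := by field_simp
      nlinarith [this, hδL]
    have h3 : (n' : ℝ) * (M / L) ≤ n' * (2 * q) := mul_le_mul_of_nonneg_left hML.le (Nat.cast_nonneg _)
    have : (mp : ℝ) < n + 2 * n' * q + 1 := by nlinarith
    have : mp < n + 2 * n' * q + 1 := by exact_mod_cast this
    rw [hA]; omega
  have hmqB : n' + mq ≤ B := by
    have h1 : (mq : ℝ) ≤ 2 * c / M := Nat.floor_le (by positivity)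
    have h2 : 2 * c / M ≤ n' + n * (L / M) + 1 / 2 := by
      rw [hc, div_le_iff₀ hM0]
      have : n * (L / M) * M = n * L := by field_simp
      nlinarith [this, hδM]
    have h3 : (n : ℝ) * (L / M) ≤ n * (2 * p) := mul_le_mul_of_nonneg_left hLM.le (Nat.cast_nonneg _)
    have : (mq : ℝ) < n' + 2 * n * p + 1 := by nlinarith
    have : mq < n' + 2 * n * p + 1 := by exact_mod_cast this
    rw [hB]; omega
  obtain ⟨hGt, hGs⟩ := comb2_isWeilTest_tsupport hG hh hs hL0.le hM0.le
  refine ⟨c, G, hGt, by rw [hc]; exact hGs, ?_, ?_⟩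
  · rw [integral_norm_sq_comb2 hG hsep hh hs (by rw [hA]; omega) (by rw [hB]; omega), hn1, mul_one]
    positivity
  · have := re_erase_erase_comb2_le hG hsep hh hs hp hq hpq hpS hqS rfl rfl hn hn' (by rw [hc] at hwp; exact hwp)
      (by rw [hc] at hwq; exact hwq) hmpA hmqB
    exact this

end Summit.RiemannHypothesis.RiemannHypothesis.Theorems.SemilocalDeletionPairCombs

end
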